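import Mathlib
import Summits.AtomisticToContinuum.FouriersLaw.Theses.ContactStieltjesMeasure
import Summits.AtomisticToContinuum.FouriersLaw.Theses.BoundaryEscapeDeficit

/-!
# Strategist sketch (crux stmt-AtomisticToContinuum-15250 `ContactMeasureLimit`) — typed census companions

Typed statements referred to by `STRATEGY-CENSUS.md` (elaboration only; `sorry` marks statements, nothing here is
registered). Namespace is scratch.

* `aprioriLocalBound` — FIRST LEMMA of the continuity theorem (`stub_stieltjesContinuity` of both lines): a monotone
  `F ≥ 0` vanishing on `(-∞,0]` is locally bounded by ONE contact transform, `F t ≤ (γ²+t²)·∫_(s>0) F k_γ`, because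
  `∫_t^∞ k_γ = (γ²+t²)⁻¹` and `F` is non-decreasing. (This is what makes Helly / RMK compactness available without (U).)
* `kernel_tail_integral` — the calculus identity behind it.
* `StieltjesContinuityWindow` — the WINDOW form of the continuity theorem (Strengthen/Transfer entry S-2 / T-3):
  convergence of the transforms for `γ` in a nonempty open interval already forces vague convergence (Stone–Weierstrass
  for the algebra generated by `(γ²+s²)⁻¹`, `γ ∈ (a,b)`: products by partial fractions, squares as uniform limits of
  difference quotients INSIDE the window).
* `EscapeWindowConvergence` — the matching weakened physical statement (Φ-free, NESS-free): the escape-deficit sequence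
  `e_N(γ) = (N−1)γE_N(γ)` converges in `ℝ` for every `γ` in SOME open friction window. Census verdict: typed, composes,
  but NO leverage (no friction regime is uniform in `N`; sibling triage of `stieltjes-contact-rigidity` on 9141:
  "relocation, not reduction") — deliberately NOT registered as a line.
* `ContactLadder` — the upward strengthening tried under Strengthen S-3 (eventual monotonicity in `N` of `N·Φ_N(t)`),
  recorded as refuted-as-necessary by the 9141 lane's parity witness in `E`-form; not filed.
-/

noncomputable section

namespace Summit.AtomisticToContinuum.FouriersLaw.Cruxes.ContactMeasureLimit.StrategistB1

open Filter MeasureTheory Set Topology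
open Literature.MathematicalPhysics.KineticTheory.HeatConduction

/-- Calculus: `∫_(s>t) 2s/(γ²+s²)² ds = (γ²+t²)⁻¹` for `γ > 0`, `t ≥ 0` (antiderivative `−(γ²+s²)⁻¹`). [folklore] -/
theorem kernel_tail_integral {γ : ℝ} (hγ : 0 < γ) {t : ℝ} (ht : 0 ≤ t) :
    ∫ s in Set.Ioi t, 2 * s / (γ ^ 2 + s ^ 2) ^ 2 = (γ ^ 2 + t ^ 2)⁻¹ := by
  sorry

/-- FIRST LEMMA of the continuity theorem: a priori local bound from ONE friction. For `F` monotone, vanishing on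
`(-∞,0]` and bounded above, and any `γ > 0`, `t > 0`: `F t ≤ (γ²+t²) · ∫_(s>0) F(s)·2s/(γ²+s²)² ds`. [folklore] -/
theorem aprioriLocalBound (F : ℝ → ℝ) (hmono : Monotone F) (hzero : ∀ s : ℝ, s ≤ 0 → F s = 0)
    (hbdd : ∃ m : ℝ, ∀ s : ℝ, F s ≤ m) {γ : ℝ} (hγ : 0 < γ) {t : ℝ} (ht : 0 < t) :
    F t ≤ (γ ^ 2 + t ^ 2) * ∫ s in Set.Ioi (0 : ℝ), F s * (2 * s / (γ ^ 2 + s ^ 2) ^ 2) := by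
  sorry

/-- WINDOW form of the Stieltjes continuity theorem (pure real analysis; strictly stronger than the registered
`stub_stieltjesContinuity`, same proof through Stone–Weierstrass on `[0,∞]` + Riesz–Markov): convergence of the
contact transforms for every friction in a nonempty OPEN INTERVAL suffices. -/
def StieltjesContinuityWindow : Prop :=
  ∀ F : ℕ → ℝ → ℝ,
    (∀ N : ℕ, Monotone (F N) ∧ (∀ s : ℝ, s ≤ 0 → F N s = 0) ∧ (∃ m : ℝ, ∀ s : ℝ, F N s ≤ m)) →
    (∃ a b : ℝ, 0 < a ∧ a < b ∧ ∀ γ ∈ Set.Ioo a b, ∃ L : ℝ,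
      Filter.Tendsto (fun N : ℕ => ∫ t in Set.Ioi (0 : ℝ), F N t * (2 * t / (γ ^ 2 + t ^ 2) ^ 2))
        Filter.atTop (nhds L)) →
    ∃ M : ℝ → ℝ, Monotone M ∧ ∀ t : ℝ, 0 < t → ContinuousAt M t →
      Filter.Tendsto (fun N : ℕ => F N t) Filter.atTop (nhds (M t))

/-- The weakened physical statement matching the window theorem (Φ-free, NESS-free, over the landed vocabulary of
route `BoundaryEscapeDeficit`): for all parameters `> 0` and `T > 0` there is an open friction window on which the
escape-deficit sequence `e_N(γ) = (N−1)·γ·E_N(γ)` converges in `ℝ`. Modulo the response identity and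
`StieltjesContinuityWindow` it implies (M); modulo K2 ∧ (U) it is implied by (M). Census: no leverage — not filed. -/
def EscapeWindowConvergence : Prop :=
  ∀ ω₂ lam β : ℝ, 0 < ω₂ → 0 < lam → 0 < β → ∀ T : ℝ, 0 < T →
    ∃ a b : ℝ, 0 < a ∧ a < b ∧ ∀ γ ∈ Set.Ioo a b,
      (let P := pinnedChain ω₂ lam β γ
       let K : ℕ → ℝ → ℝ := fun N u => if h : 0 < N then
         ∫ z, ((z.2 ⟨0, h⟩) ^ 2 - T) * (∫ y, ((y.2 ⟨0, h⟩) ^ 2 - T) ∂(P.transitionKernel N T T u.toNNReal z))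
           ∂(P.gibbsMeasure N T) else 0
       let E : ℕ → ℝ := fun N => 1 - γ / T ^ 2 * ∫ u in Set.Ioi (0 : ℝ), K N u
       ∃ ℓ : ℝ, Filter.Tendsto (fun N : ℕ => ((N : ℝ) - 1) * γ * E N) Filter.atTop (nhds ℓ))

/-- Strengthen S-3 (REJECTED): the contact ladder — eventual monotonicity in `N` of the scaled contact distribution
functions at each scale. With the a priori bound it would give (M) by monotone convergence; it is the measure-side
twin of the length-monotone / Kubo ladder of crux 9141, shown NOT necessary for Fourier behaviour by the parity witness
of that lane (`fourierShape_not_upperIncrement_nor_ladder`); typed here only to record what was tried. -/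
def ContactLadder : Prop :=
  ∀ ω₂ lam β : ℝ, 0 < ω₂ → 0 < lam → 0 < β → ∀ T : ℝ, 0 < T → ∀ Φ : ℕ → ℝ → ℝ,
    (∀ N : ℕ, 2 ≤ N → Monotone (Φ N) ∧ (∀ s : ℝ, s ≤ 0 → Φ N s = 0) ∧ (∃ m : ℝ, ∀ s : ℝ, Φ N s ≤ m) ∧
      ∀ γ : ℝ, 0 < γ →
        (∀ (N' : ℕ) (T_L T_R : ℝ), 0 < T_L → 0 < T_R →
          ∀ μ ν : MeasureTheory.Measure (PhaseSpace N'),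
            (pinnedChain ω₂ lam β γ).IsSteadyState N' T_L T_R μ →
            (pinnedChain ω₂ lam β γ).IsSteadyState N' T_L T_R ν → μ = ν) →
        ∀ μ : (N' : ℕ) → ℝ → ℝ → MeasureTheory.Measure (PhaseSpace N'),
          (∀ (N' : ℕ) (T_L T_R : ℝ), 0 < T_L → 0 < T_R →
            (pinnedChain ω₂ lam β γ).IsSteadyState N' T_L T_R (μ N' T_L T_R)) →
          Filter.Tendsto (fun δ : ℝ =>
            (pinnedChain ω₂ lam β γ).totalCurrent (μ N (T + δ / 2) (T - δ / 2)) / δ) (nhdsWithin 0 {(0 : ℝ)}ᶜ)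
            (nhds (((N : ℝ) - 1) * γ * ∫ t in Set.Ioi (0 : ℝ), Φ N t * (2 * t / (γ ^ 2 + t ^ 2) ^ 2)))) →
    ∀ t : ℝ, 0 < t → ∃ N₀ : ℕ, ∀ N : ℕ, N₀ ≤ N → (N : ℝ) * Φ N t ≤ ((N : ℝ) + 1) * Φ (N + 1) t

/-- Sanity: the window theorem implies the registered all-frictions stub (instantiate the window `(1,2)`). -/
example (h : StieltjesContinuityWindow) :
    ∀ F : ℕ → ℝ → ℝ,
      (∀ N : ℕ, Monotone (F N) ∧ (∀ s : ℝ, s ≤ 0 → F N s = 0) ∧ (∃ m : ℝ, ∀ s : ℝ, F N s ≤ m)) →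
      (∀ γ : ℝ, 0 < γ → ∃ L : ℝ,
        Filter.Tendsto (fun N : ℕ => ∫ t in Set.Ioi (0 : ℝ), F N t * (2 * t / (γ ^ 2 + t ^ 2) ^ 2))
          Filter.atTop (nhds L)) →
      ∃ M : ℝ → ℝ, Monotone M ∧ ∀ t : ℝ, 0 < t → ContinuousAt M t →
        Filter.Tendsto (fun N : ℕ => F N t) Filter.atTop (nhds (M t)) := by
  intro F hF hC
  exact h F hF ⟨1, 2, one_pos, one_lt_two, fun γ hγ => hC γ (lt_trans one_pos hγ.1)⟩

end Summit.AtomisticToContinuum.FouriersLaw.Cruxes.ContactMeasureLimit.StrategistB1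

end
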